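import Summits.ResolutionOfSingularities.ResolutionOfSingularities.Theorems.FrobeniusClosingPatchingRelPerfectDepthTargetsWeightedDefs
import Summits.ResolutionOfSingularities.ResolutionOfSingularities.Theorems.FrobeniusClosingPatchingRelPerfectDepthTargetsDefs
import Summits.ResolutionOfSingularities.ResolutionOfSingularities.Theorems.FrobeniusClosingPatchingRelPerfectDepthMixedDictionaryStep
import HarnessLib

/-!
# Crux `PatchingRelPerfect` (stmt-ResolutionOfSingularities-16161), chain W5.2 — rung R4ˢ-general, X-side:
# the depth-`ℓ` invariant WITH MONOMIAL CONTACT and the MIXED TOWER along an arbitrary weighted sequence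

[OURS · L1 W5.2 · rung tool] Replaces the role of NO printed item; NOT statements of the manuscript under review;
fact-free. KERNEL SENTENCE v1.6 (res-L1-w52-plan-1, STATUS 2026-08-27T05:26:19Z / CHAIN v1.6 §4): a blowing up of
the regular threefold `E` along a regular centre `C` that is permissible only with a DEFICIENT weight `ν < ℓ`
degrades the literal maximal contact `𝓘_E^ℓ ≤ K` of the depth-`ℓ` invariant (F1 `DepthInvariant ℓ`, p498219) to
MONOMIAL contact `N · 𝓘_{E'}^ℓ ≤ K'`, `N` the accumulated exceptional monomial `∏_j 𝓘_{exc,j}^{ℓ-ν_j}`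
(res-D-pv-009's mixed dictionary step D1^{ℓ,ν}, `DepthOne.dictionaryStep_mixed`, p502493); the part of the
cosupport of `K'` that leaves the strict transform of `E` ESCAPES onto the carriers of `N` (problems of smaller
depth there). This file is the X-side bookkeeping of that regime, FORMAT-GENERIC exactly as res-D-pv-016's pure
tower S-T (`StepPow` / `TowerPow`, `…DepthSingletonTower.lean`, p502874):

* §1 `DepthInvariantMono ℓ S I E X i g K N` — `DepthInvariant ℓ` with `ker_pow_le` replaced by an effective
  Cartier MONOMIAL `N`, cosupported over the closed point, with `N · 𝓘_E^ℓ ≤ K`; `of_depthInvariant` /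
  `depthInvariant_of_top` (`N = ⊤` is the literal invariant); **`DepthInvariantMono.step`** (D1^{ℓ,ν} repackaged:
  X-side permissible with weight `ν ≤ ℓ` ⇒ the invariant at `(σᶜ(K, ν), σ^*N · 𝓘_{exc}^{ℓ-ν})` with
  `K'|_{E'} = τᶜ(K|_E, ν)`); the END lemmas `support_subset_of_comap_eq_top` (`K|_E = ⊤` ⇒ `supp K ⊆ supp N`,
  over the closed point — the escaped locus) and `eq_top_of_top_of_comap_eq_top` (`N = ⊤` ⇒ `K = ⊤`).
* §2 `StepMixed ℓ P` / `TowerMixed ℓ P` for a format predicate `P i K N` (weights `1 ≤ ν ≤ ℓ`; the tower runs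
  along an ARBITRARY `IsWeightedSeq ℓ` of F2, p502025, e.g. W₂'s weight-`≤ 2` sequence, and records the X-side
  sequence as an `IsWeightedSeq ℓ` along the pushed centres with the same weights); PROVED
  **`towerMixed_of_stepMixed`** (induction on the weighted sequence) and `stepMixed_of_transfer_of_propagate`
  (a permissibility TRANSFER + a PROPAGATION of `P` through D1^{ℓ,ν} give the formatted step).
* §3 `le_map_of_comap_le` — at weight one the transfer is free (`K|_E ≤ C ⇒ K ≤ C.map i`).

The format of record for the deficient-weight regime (the local retraction model with monomial,
`K|_V = r^*𝔟 ⊔ N|_V · 𝓘_E^ℓ|_V`, res-L1-w52-lead-1's `LocGradedFormat` × res-D-pv-009's mixed retraction law) is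
instantiated in a companion file. AI-written, weaker than expert review.

## References
* E. Bierstone, D. Grigoriev, P. Milman, J. Włodarczyk, arXiv:1206.3090, §3.1 Def. 3.1.3, §3.2 Lemma 3.2.1.
  [BierstoneGrigorievMilmanWlodarczyk2011]
* U. Görtz, T. Wedhorn, *Algebraic Geometry I*, 2nd ed. (2020), Prop. 13.91 (1), 13.96 (2), (13.19).
  [GortzWedhorn2020]
* J. Kollár, *Lectures on Resolution of Singularities* (2007), 3.30.2, (3.111) Step 3. [Kollar2007]
-/

-- `Summit.<Summit>.<Sub>.Theorems` with `Sub = Summit` (single-conjunct summit, D-0017)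
set_option linter.dupNamespace false

noncomputable section

open CategoryTheory CategoryTheory.Limits AlgebraicGeometry TopologicalSpace
open Literature.AlgebraicGeometry.Resolution
open Scheme.IdealSheafData

namespace Summit.ResolutionOfSingularities.ResolutionOfSingularities.Theorems.DepthTargets

universe u

/-! ## §1 The invariant with monomial contact -/

/-- [OURS · L1 W5.2] **The depth-`ℓ` invariant with MONOMIAL contact** `N · 𝓘_E^ℓ ≤ K` (kernel sentence v1.6:
weights `ν < ℓ` degrade literal maximal contact to monomial contact, `N` the accumulated exceptional monomial
`∏ 𝓘_{exc,j}^{ℓ-ν_j}`, cosupported over the closed point). [cite: Kollar2007, (3.111) Step 3]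
[cite: GortzWedhorn2020, Prop. 13.91 (1), 13.96 (2)] -/
structure DepthInvariantMono (ℓ : ℕ) (S : Type u) [CommRing S] [IsRegularLocalRing S] (I : Ideal S)
    (E X : Scheme.{u}) (i : E ⟶ X) (g : X ⟶ Spec (.of S)) (K N : X.IdealSheafData) : Prop where
  /-- `X` is Noetherian -/
  isNoetherian : IsNoetherian X
  /-- `X` is regular -/
  isRegular : Scheme.IsRegular X
  /-- `E` is regular -/
  isRegular_exc : Scheme.IsRegular E
  /-- `i : E ⟶ X` is a closed immersion … -/
  isClosedImmersion : IsClosedImmersion i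
  /-- … whose ideal is an effective Cartier divisor -/
  isEffectiveCartier_ker : IsEffectiveCartier i.ker
  /-- `E` lies over the closed point of `Spec S` -/
  map_eq_closedPoint : ∀ e : E, g.base (i.base e) = IsLocalRing.closedPoint S
  /-- `g` is a blowing up along an ideal sheaf cosupported in the closed point -/
  exists_isBlowup_supported : ∃ K₀ : (Spec (.of S)).IdealSheafData, IsBlowup g K₀ ∧
    (K₀.support : Set (Spec (.of S))) ⊆ {IsLocalRing.closedPoint S}
  /-- the contact monomial `N` is an effective Cartier ideal … -/
  isEffectiveCartier_mono : IsEffectiveCartier N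
  /-- … cosupported over the closed point -/
  mono_support : ∀ x : X, x ∈ (N.support : Set X) → g.base x = IsLocalRing.closedPoint S
  /-- MONOMIAL CONTACT: `N · 𝓘_E^ℓ ≤ K` -/
  mul_ker_pow_le : N * i.ker ^ ℓ ≤ K
  /-- the FORMAT `I𝒪_X = M · K`, `M` invertible -/
  exists_format : ∃ M : X.IdealSheafData, IsEffectiveCartier M ∧
    (affineBlowup.idealSheaf I).comap g = M * K

namespace DepthInvariantMono

variable {ℓ : ℕ} {S : Type u} [CommRing S] [IsRegularLocalRing S] {I : Ideal S}
  {E X : Scheme.{u}} {i : E ⟶ X} {g : X ⟶ Spec (.of S)} {K N : X.IdealSheafData}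

/-- Literal contact is monomial contact with the unit monomial. [folklore] -/
theorem of_depthInvariant (h : DepthInvariant ℓ S I E X i g K) : DepthInvariantMono ℓ S I E X i g K ⊤ where
  isNoetherian := h.isNoetherian
  isRegular := h.isRegular
  isRegular_exc := h.isRegular_exc
  isClosedImmersion := h.isClosedImmersion
  isEffectiveCartier_ker := h.isEffectiveCartier_ker
  map_eq_closedPoint := h.map_eq_closedPoint
  exists_isBlowup_supported := h.exists_isBlowup_supported
  isEffectiveCartier_mono := by
    simpa using (h.isEffectiveCartier_ker.pow 0)
  mono_support := fun x hx => by
    rw [Scheme.IdealSheafData.support_top] at hx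
    exact absurd hx id
  mul_ker_pow_le := by rw [top_mul]; exact h.ker_pow_le
  exists_format := h.exists_format

/-- Monomial contact with the unit monomial is literal contact. [folklore] -/
theorem depthInvariant_of_top (h : DepthInvariantMono ℓ S I E X i g K ⊤) : DepthInvariant ℓ S I E X i g K where
  isNoetherian := h.isNoetherian
  isRegular := h.isRegular
  isRegular_exc := h.isRegular_exc
  isClosedImmersion := h.isClosedImmersion
  isEffectiveCartier_ker := h.isEffectiveCartier_ker
  map_eq_closedPoint := h.map_eq_closedPoint
  exists_isBlowup_supported := h.exists_isBlowup_supported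
  ker_pow_le := by simpa [top_mul] using h.mul_ker_pow_le
  exists_format := h.exists_format

/-- **The mixed step on the invariant** (pv-009's D1^{ℓ,ν} `DepthOne.dictionaryStep_mixed_controlledTransform`
repackaged): a blowing up of `E` along a regular centre `C`, permissible ON THE X-SIDE with weight `ν ≤ ℓ`
(`K ≤ Ĉ^ν`, `Ĉ = C.map i`), is matched by the blowing up `σ` of `X` along `Ĉ`, re-establishing the invariant at
`K' = σᶜ(K, ν)`, `N' = σ^*N · 𝓘_{exc}^{ℓ-ν}`, with `K'|_{E'} = τᶜ(K|_E, ν)`.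
[cite: BierstoneGrigorievMilmanWlodarczyk2011, §3.2 Lemma 3.2.1] [cite: GortzWedhorn2020, Prop. 13.91 (1), Prop. 13.96 (2)] -/
theorem step (h : DepthInvariantMono ℓ S I E X i g K N) {ν : ℕ} (hνℓ : ν ≤ ℓ)
    {E' : Scheme.{u}} (τ : E' ⟶ E) (C : E.IdealSheafData) (hC : Scheme.IsRegular C.subscheme)
    (hKC : K ≤ (C.map i) ^ ν) (hτ : IsBlowup τ C) :
    ∃ (X' : Scheme.{u}) (σ : X' ⟶ X) (i' : E' ⟶ X'),
      IsBlowup σ (C.map i) ∧ i' ≫ σ = τ ≫ i ∧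
      DepthInvariantMono ℓ S I E' X' i' (σ ≫ g) (controlledTransform σ (C.map i) K ν)
        (N.comap σ * (C.map i).comap σ ^ (ℓ - ν)) ∧
      (controlledTransform σ (C.map i) K ν).comap i' = controlledTransform τ C (K.comap i) ν := by
  haveI := h.isNoetherian
  haveI := h.isClosedImmersion
  obtain ⟨M, hM, hIMK⟩ := h.exists_format
  obtain ⟨X', σ, hσ, hτ', hX'N, hX'reg, hE'reg, hi', hkerE', -, hEpt', hg', hM', hN', hNK', hKE', hIMK'⟩ :=
    DepthOne.dictionaryStep_mixed_controlledTransform I hνℓ i g h.isRegular h.isRegular_exc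
      h.isEffectiveCartier_ker h.map_eq_closedPoint h.exists_isBlowup_supported M N K hM
      h.isEffectiveCartier_mono h.mul_ker_pow_le hIMK τ C hC hKC hτ
  refine ⟨X', σ, hσ.strictTransformHom hτ', hσ, hσ.strictTransformHom_comp hτ', ?_, hKE'⟩
  exact { isNoetherian := hX'N
          isRegular := hX'reg
          isRegular_exc := hE'reg
          isClosedImmersion := hi'
          isEffectiveCartier_ker := hkerE'
          map_eq_closedPoint := hEpt'
          exists_isBlowup_supported := hg'
          isEffectiveCartier_mono := hN'
          mono_support := DepthOne.monomial_support_over_closedPoint i g σ N C (ℓ - ν) h.mono_support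
            h.map_eq_closedPoint
          mul_ker_pow_le := hNK'
          exists_format := ⟨_, hM', hIMK'⟩ }

/-- **Mixed END — where the residual escapes to**: once the E-side ideal is resolved (`K|_E = ⊤`), the cosupport
of `K` lies on the contact monomial `N` only (pv-009's `DepthOne.support_subset_of_mul_ker_pow_le_of_comap_eq_top`),
hence over the closed point. [cite: GortzWedhorn2020, (13.19) p. 414] -/
theorem support_subset_of_comap_eq_top (h : DepthInvariantMono ℓ S I E X i g K N) (hKi : K.comap i = ⊤) :
    (K.support : Set X) ⊆ N.support ∧ ∀ x : X, x ∈ (K.support : Set X) → g.base x = IsLocalRing.closedPoint S := by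
  haveI := h.isClosedImmersion
  have hsub : (K.support : Set X) ⊆ N.support :=
    DepthOne.support_subset_of_mul_ker_pow_le_of_comap_eq_top i h.mul_ker_pow_le hKi
  exact ⟨hsub, fun x hx => h.mono_support x (hsub hx)⟩

/-- **Mixed END with the unit monomial**: `N = ⊤` and `K|_E = ⊤` give `K = ⊤` (the depth-`ℓ` END of
`…DepthOneEndPow.lean` in the monomial vocabulary: empty cosupport). [cite: GortzWedhorn2020, (13.19) p. 414] -/
theorem eq_top_of_top_of_comap_eq_top (h : DepthInvariantMono ℓ S I E X i g K ⊤) (hKi : K.comap i = ⊤) :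
    K = ⊤ := by
  have hsub := (h.support_subset_of_comap_eq_top hKi).1
  rw [Scheme.IdealSheafData.support_top] at hsub
  rw [← Scheme.IdealSheafData.support_eq_bot_iff]
  exact le_bot_iff.mp fun x hx => hsub hx

end DepthInvariantMono

/-! ## §2 The formatted mixed step and the mixed tower -/

/-- [OURS · L1 W5.2] **One mixed step WITH A FORMAT `P`** on `(i, K, N)`: at a state of the monomial-contact
invariant carrying `P i K N`, a blowing up `τ : E' → E` along a regular centre `C`, permissible on the E-side with
weight `ν` (`1 ≤ ν ≤ ℓ`, `K|_E ≤ C^ν`), is (1) permissible on the X-side, `K ≤ Ĉ^ν` (TRANSFER), and (2) matched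
by a blowing up `σ` along `Ĉ` re-establishing the invariant at `(σᶜ(K, ν), σ^*N · 𝓘_{exc}^{ℓ-ν})` with
`K'|_{E'} = τᶜ(K|_E, ν)` AND the format again (PROPAGATION). [cite: BierstoneGrigorievMilmanWlodarczyk2011, §3.2 Lemma 3.2.1, Def. 3.1.3] -/
def StepMixed (ℓ : ℕ) (P : ∀ ⦃E X : Scheme.{u}⦄, (E ⟶ X) → X.IdealSheafData → X.IdealSheafData → Prop) : Prop :=
  ∀ (S : Type u) [CommRing S] [IsRegularLocalRing S] (I : Ideal S)
    (E X : Scheme.{u}) (i : E ⟶ X) (g : X ⟶ Spec (.of S)) (K N : X.IdealSheafData),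
    DepthInvariantMono ℓ S I E X i g K N → P i K N →
    ∀ (E' : Scheme.{u}) (τ : E' ⟶ E) (C : E.IdealSheafData) (ν : ℕ),
      Scheme.IsRegular C.subscheme → 1 ≤ ν → ν ≤ ℓ → K.comap i ≤ C ^ ν → IsBlowup τ C →
        K ≤ C.map i ^ ν ∧
        ∃ (X' : Scheme.{u}) (σ : X' ⟶ X) (i' : E' ⟶ X'),
          IsBlowup σ (C.map i) ∧ i' ≫ σ = τ ≫ i ∧
          DepthInvariantMono ℓ S I E' X' i' (σ ≫ g) (controlledTransform σ (C.map i) K ν)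
            (N.comap σ * (C.map i).comap σ ^ (ℓ - ν)) ∧
          (controlledTransform σ (C.map i) K ν).comap i' = controlledTransform τ C (K.comap i) ν ∧
          P i' (controlledTransform σ (C.map i) K ν) (N.comap σ * (C.map i).comap σ ^ (ℓ - ν))

/-- [OURS · L1 W5.2] **The MIXED TOWER with a format `P`**: every weighted sequence `ρ : E' → E` of the
exceptional threefold with weights `≤ ℓ` (`IsWeightedSeq ℓ`, F2) starting from `K|_E` is matched by a weighted
sequence `π : X' → X` of the ambient scheme along the pushed centres, with `E'` the iterated strict transform,
the monomial-contact invariant at the end, `K'|_{E'} = 𝔟'`, and the format again.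
[cite: Kollar2007, 3.30.2, (3.111) Step 3] [cite: BierstoneGrigorievMilmanWlodarczyk2011, Def. 3.1.3, §3.2] -/
def TowerMixed (ℓ : ℕ) (P : ∀ ⦃E X : Scheme.{u}⦄, (E ⟶ X) → X.IdealSheafData → X.IdealSheafData → Prop) : Prop :=
  ∀ (S : Type u) [CommRing S] [IsRegularLocalRing S] (I : Ideal S)
    (E X : Scheme.{u}) (i : E ⟶ X) (g : X ⟶ Spec (.of S)) (K N : X.IdealSheafData),
    DepthInvariantMono ℓ S I E X i g K N → P i K N →
    ∀ (E' : Scheme.{u}) (ρ : E' ⟶ E) (𝔟' : E'.IdealSheafData),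
      IsWeightedSeq ℓ ρ (K.comap i) 𝔟' →
        ∃ (X' : Scheme.{u}) (π : X' ⟶ X) (i' : E' ⟶ X') (K' N' : X'.IdealSheafData),
          IsWeightedSeq ℓ π K K' ∧ i' ≫ π = ρ ≫ i ∧
          DepthInvariantMono ℓ S I E' X' i' (π ≫ g) K' N' ∧ K'.comap i' = 𝔟' ∧ P i' K' N'

/-- The last ideal of a weighted step is the controlled transform: from `𝔟'𝒪 = (C𝒪)^ν · 𝔟''` and `𝔟' ≤ C^ν`,
`𝔟'' = τᶜ(𝔟', ν)` (cancel the effective Cartier divisor `(C𝒪)^ν`). [cite: BierstoneGrigorievMilmanWlodarczyk2011, §3.2 Lemma 3.2.1] -/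
theorem eq_controlledTransform_of_comap_eq_weighted {E'' E' : Scheme.{u}} {τ : E'' ⟶ E'}
    {C 𝔟' : E'.IdealSheafData} {𝔟'' : E''.IdealSheafData} {ν : ℕ} (hτ : IsBlowup τ C) (hle : 𝔟' ≤ C ^ ν)
    (heq : 𝔟'.comap τ = C.comap τ ^ ν * 𝔟'') : 𝔟'' = controlledTransform τ C 𝔟' ν := by
  apply (hτ.isEffectiveCartier.pow ν).eq_of_mul_eq_mul
  rw [← heq, hτ.pow_mul_controlledTransform_eq]
  have h : 𝔟'.comap τ ≤ (C ^ ν).comap τ := Scheme.IdealSheafData.comap_mono (f := τ) hle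
  rwa [comap_pow] at h

/-- [OURS · L1 W5.2] **The mixed tower from the mixed step**: a format that survives one weighted step survives
every weighted sequence (induction on `IsWeightedSeq ℓ`, the X-side steps recorded as weighted steps along the
pushed centres `Ĉ_j = C_j.map i_j` with the same weights). [cite: BierstoneGrigorievMilmanWlodarczyk2011, Def. 3.1.3, §3.2 Lemma 3.2.1]
[cite: Kollar2007, (3.111) Step 3] -/
theorem towerMixed_of_stepMixed {ℓ : ℕ}
    {P : ∀ ⦃E X : Scheme.{u}⦄, (E ⟶ X) → X.IdealSheafData → X.IdealSheafData → Prop}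
    (hstep : StepMixed ℓ P) : TowerMixed ℓ P := by
  have key : ∀ {E' E : Scheme.{u}} {ρ : E' ⟶ E} {𝔟 : E.IdealSheafData} {𝔟' : E'.IdealSheafData},
      IsWeightedSeq ℓ ρ 𝔟 𝔟' →
      ∀ (S : Type u) [CommRing S] [IsRegularLocalRing S] (I : Ideal S) (X : Scheme.{u}) (i : E ⟶ X)
        (g : X ⟶ Spec (.of S)) (K N : X.IdealSheafData),
        DepthInvariantMono ℓ S I E X i g K N → P i K N → K.comap i = 𝔟 →
        ∃ (X' : Scheme.{u}) (π : X' ⟶ X) (i' : E' ⟶ X') (K' N' : X'.IdealSheafData),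
          IsWeightedSeq ℓ π K K' ∧ i' ≫ π = ρ ≫ i ∧
          DepthInvariantMono ℓ S I E' X' i' (π ≫ g) K' N' ∧ K'.comap i' = 𝔟' ∧ P i' K' N' := by
    intro E' E ρ 𝔟 𝔟' hseq
    induction hseq with
    | nil 𝔟 =>
      intro S _ _ I X i g K N hinv hP h𝔟
      exact ⟨X, 𝟙 X, i, K, N, .nil K, by simp, by simpa using hinv, h𝔟, hP⟩
    | cons τ ρ 𝔟 𝔟₁ 𝔟₂ C ν hρ hC h1 hν hle hτ heq ih =>
      intro S _ _ I X i g K N hinv hP h𝔟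
      obtain ⟨X₁, π, i₁, K₁, N₁, hXseq, hsq, hinv₁, hK₁, hP₁⟩ := ih S I X i g K N hinv hP h𝔟
      have hle' : K₁.comap i₁ ≤ C ^ ν := hK₁ ▸ hle
      obtain ⟨hperm, X₂, σ, i₂, hσ, hsq₂, hinv₂, hK₂, hP₂⟩ :=
        hstep S I _ X₁ i₁ (π ≫ g) K₁ N₁ hinv₁ hP₁ _ τ C ν hC h1 hν hle' hτ
      haveI := hinv₁.isClosedImmersion
      refine ⟨X₂, σ ≫ π, i₂, controlledTransform σ (C.map i₁) K₁ ν,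
        N₁.comap σ * (C.map i₁).comap σ ^ (ℓ - ν), ?_, ?_, ?_, ?_, hP₂⟩
      · refine .cons σ π K K₁ _ (C.map i₁) ν hXseq (DepthOne.isRegular_subscheme_map i₁ C hC) h1 hν hperm hσ ?_
        refine (hσ.pow_mul_controlledTransform_eq ?_).symm
        have h : K₁.comap σ ≤ ((C.map i₁) ^ ν).comap σ :=
          Scheme.IdealSheafData.comap_mono (f := σ) hperm
        rwa [comap_pow] at h
      · rw [Category.assoc, ← hsq, ← Category.assoc, hsq₂, Category.assoc]
      · rw [Category.assoc]; exact hinv₂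
      · rw [hK₂, hK₁]; exact (eq_controlledTransform_of_comap_eq_weighted hτ hle heq).symm
  intro S _ _ I E X i g K N hinv hP E' ρ 𝔟' hseq
  exact key hseq S I X i g K N hinv hP rfl

/-- **How to build a formatted mixed step**: a permissibility TRANSFER for `P` at every weight `1 ≤ ν ≤ ℓ` and a
PROPAGATION of `P` through the output of the mixed dictionary step give `StepMixed ℓ P`, the step itself being
`DepthInvariantMono.step` (pv-009's D1^{ℓ,ν}). [cite: BierstoneGrigorievMilmanWlodarczyk2011, §3.2 Lemma 3.2.1]
[cite: GortzWedhorn2020, Prop. 13.91 (1), Prop. 13.96 (2)] -/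
theorem stepMixed_of_transfer_of_propagate {ℓ : ℕ}
    {P : ∀ ⦃E X : Scheme.{u}⦄, (E ⟶ X) → X.IdealSheafData → X.IdealSheafData → Prop}
    (htransfer : ∀ (S : Type u) [CommRing S] [IsRegularLocalRing S] (I : Ideal S)
      (E X : Scheme.{u}) (i : E ⟶ X) (g : X ⟶ Spec (.of S)) (K N : X.IdealSheafData),
      DepthInvariantMono ℓ S I E X i g K N → P i K N →
      ∀ (C : E.IdealSheafData) (ν : ℕ), Scheme.IsRegular C.subscheme → 1 ≤ ν → ν ≤ ℓ →
        K.comap i ≤ C ^ ν → K ≤ C.map i ^ ν)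
    (hpropagate : ∀ (S : Type u) [CommRing S] [IsRegularLocalRing S] (I : Ideal S)
      (E X : Scheme.{u}) (i : E ⟶ X) (g : X ⟶ Spec (.of S)) (K N : X.IdealSheafData),
      DepthInvariantMono ℓ S I E X i g K N → P i K N →
      ∀ (E' : Scheme.{u}) (τ : E' ⟶ E) (C : E.IdealSheafData) (ν : ℕ),
        Scheme.IsRegular C.subscheme → 1 ≤ ν → ν ≤ ℓ → K.comap i ≤ C ^ ν → IsBlowup τ C →
        ∀ (X' : Scheme.{u}) (σ : X' ⟶ X) (i' : E' ⟶ X'), IsBlowup σ (C.map i) → i' ≫ σ = τ ≫ i →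
          DepthInvariantMono ℓ S I E' X' i' (σ ≫ g) (controlledTransform σ (C.map i) K ν)
            (N.comap σ * (C.map i).comap σ ^ (ℓ - ν)) →
          (controlledTransform σ (C.map i) K ν).comap i' = controlledTransform τ C (K.comap i) ν →
          P i' (controlledTransform σ (C.map i) K ν) (N.comap σ * (C.map i).comap σ ^ (ℓ - ν))) :
    StepMixed ℓ P := by
  intro S _ _ I E X i g K N hinv hP E' τ C ν hC h1 hν hle hτ
  have hperm : K ≤ C.map i ^ ν := htransfer S I E X i g K N hinv hP C ν hC h1 hν hle
  obtain ⟨X', σ, i', hσ, hsq, hinv', hK'⟩ := hinv.step hν τ C hC hperm hτ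
  exact ⟨hperm, X', σ, i', hσ, hsq, hinv', hK',
    hpropagate S I E X i g K N hinv hP E' τ C ν hC h1 hν hle hτ X' σ i' hσ hsq hinv' hK'⟩

/-! ## §3 Weight-one steps need no format -/

/-- **Transfer at weight one is free**: `K|_E ≤ C` gives `K ≤ C.map i` (the Galois connection `comap ⊣ map` of
ideal sheaves along the closed immersion), whatever the format. [cite: GortzWedhorn2020, Prop. 13.91 (1)] -/
theorem le_map_of_comap_le {E X : Scheme.{u}} (i : E ⟶ X) {K : X.IdealSheafData} {C : E.IdealSheafData}
    (hle : K.comap i ≤ C ^ 1) : K ≤ C.map i ^ 1 := by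
  rw [pow_one] at hle ⊢
  exact Scheme.IdealSheafData.le_map_iff_comap_le.mpr hle

end Summit.ResolutionOfSingularities.ResolutionOfSingularities.Theorems.DepthTargets

end
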